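import Summits.BirchSwinnertonDyer.BirchSwinnertonDyer.Theorems.ThetaPartnerAtTwoSignedControlAtTwoPlusLayerTwoPoints
import Mathlib.Topology.Algebra.Module.FiniteDimension
import HarnessLib

/-!
# The `ℤ₂`-LAYERS AT `2` of the cyclotomic `ℤ₂`-extension, III (the plus FIELDS): `ℚ_{2,n}·ℚ₂ = ℚ₂(u_{n+2})`,
# `u_m = ζ_{2^m} + ζ_{2^m}⁻¹`, as the intermediate field `ℚ_[2]⟮u_{n+2}⟯` of `ℚ̄₂/ℚ₂` — Galois correspondence with the local layer
# subgroup `Gal(ℚ̄₂/ℚ_{2,n})` of parts I–II, inclusion in `ℚ₂(ζ_{2^{n+2}})`, membership = «in the `μ`-layer and fixed by one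
# inverter», the tower `ℚ₂(u_2) ⊆ ℚ₂(u_3) ⊆ …`, degree `[ℚ₂(u_{n+2}) : ℚ₂] = 2ⁿ`, closedness
# (K4 `SignedControlAtTwo`, stmt-BirchSwinnertonDyer-20309, line `eulerchar` v6, typing prerequisite of the stub HONDA⁺@2)

Route `ThetaPartnerAtTwo` (TP2; crux shared with `ResidualThetaTransportAtTwo`), crux K4, line `eulerchar` v6 (lead
`prover-bsd-wall-tp2-p3` g2); seat `prover-bsd-wall-tp2-p3-w2` (width seat 2/3, g2). Sequel of `…PlusLayerTwo` /
`…PlusLayerTwoPoints`.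

WHY. The (GEN) clause of HONDA⁺@2 is proved through logarithms (lead's memo LAGPLUS-AT-2-CONSTRUCTION §4: «Prop. 8.11⁺ at 2»
`Λ(Ê(k_n)) ⊆ 𝒪_{k_{n−1}}v_n + k_{n−1}`, tower lemma `(T_n)`, log descent `Λ(P) ∈ k_{n−1} ⟹ P ∈ E(k_{n−1})`), i.e. through
membership of ELEMENTS of `ℚ̄₂` in the plus fields `k_n = ℚ₂(u_{n+2})`. Parts I–II identified the GROUPS
(`Gal(ℚ̄₂/ℚ_{2,n}) = Stab(u_{n+2}) = Stab ζ_{2^{n+2}} ⊔ Stab ζ_{2^{n+2}}·σ₀`) and the layer POINTS; this file identifies the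
FIELDS, with no new definition: `k_n` is written `ℚ_[2]⟮zeta 2 (n+2) + (zeta 2 (n+2))⁻¹⟯` (Mathlib `IntermediateField.adjoin`),
exactly as the O10 series writes `ℚ_p(ζ_{p^m})` as `PadicCyclotomicTower.layer p m = ℚ_[p]⟮zeta p m⟯`.

WHAT (THEOREMS ONLY; `Ω = ℚ̄₂ = PadicAlgCl 2`, `u_m = zeta 2 m + (zeta 2 m)⁻¹`, `κ : ZpExtension ℚ 2` cyclotomic, `ι : ℚ̄ → Ω` any):
* §7 `adjoin_u_le_layer` (`ℚ₂(u_m) ≤ ℚ₂(ζ_{2^m})`); `apply_eq_self_of_apply_u_eq` / `mem_adjoin_u_of_forall_apply_eq` /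
  `mem_adjoin_u_iff_forall_apply_eq` (**Galois correspondence: `x ∈ ℚ₂(u_m) ⟺ x` is fixed by every automorphism fixing `u_m`**,
  Mathlib `InfiniteGalois.fixedField_fixingSubgroup`); `mem_fixingSubgroup_adjoin_u_iff`; `apply_mem_adjoin_u` (Galois stability).
* §8 **`mem_adjoin_u_iff_forall_mem_localLayerSubgroupOfEmb`**: `x ∈ ℚ₂(u_{n+2}) ⟺ ∀ τ ∈ Gal(ℚ̄₂/ℚ_{2,n}), τ•x = x` — the plus field
  IS the completed layer `ℚ_{2,n}·ℚ₂` of Kobayashi's Def. 1.1 for the cyclotomic `ℤ₂`-extension (any `ι`);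
  `localLayerSubgroupOfEmb_two_eq_comap_fixingSubgroup`; **`mem_adjoin_u_iff_mem_layer_and_smul_eq`**: `x ∈ ℚ₂(u_{n+2}) ⟺
  x ∈ ℚ₂(ζ_{2^{n+2}}) ∧ σ₀•x = x` for any inverter `σ₀` of `ζ_{2^{n+2}}` (the `Δ`-descent form used with the `μ`-tower files).
* §9 the tower: `u_sq_sub_two` (`u_{m+1}² − 2 = u_m`), `adjoin_u_mono`, `adjoin_u_two_eq_bot` (`u_2 = 0`: `k_0 = ℚ₂`),
  **`finrank_adjoin_u`** (`[ℚ₂(u_{n+2}) : ℚ₂] = 2ⁿ`, from `index_localLayerSubgroupOfEmb_two`), `isClosed_adjoin_u`.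

HONEST FRAMING: THEOREMS ONLY (no definition, no named fact, no instance, no `sorry`), route-independent (no `Theses`
import); Galois bookkeeping of the plus tower in `ℚ̄₂`, nothing about any elliptic curve; closes no item; BSD is not proved by
any of this.

References: [Washington1997] L. C. Washington, *Introduction to Cyclotomic Fields*, 2nd ed., §13.1 (`ℚ_n = ℚ(ζ_{2^{n+2}})⁺`),
Prop. 2.16 (`ℚ(ζ)⁺ = ℚ(ζ + ζ⁻¹)`); [Kobayashi2003] S. Kobayashi, Invent. Math. 152 (2003), Def. 1.1, §8.4;
[NeukirchANT1999] Ch. IV §1 (infinite Galois correspondence).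
-/

set_option autoImplicit false
-- the Theorems namespace of this sub repeats the summit name by design (D-0017 nested layout)
set_option linter.dupNamespace false

noncomputable section

open scoped Classical IntermediateField

namespace Summit.BirchSwinnertonDyer.BirchSwinnertonDyer.Theorems.SignedEC.PlusLayer

open Field Polynomial Literature.NumberTheory.EllipticCurves Literature.NumberTheory.GaloisRepresentations
  Literature.NumberTheory.EllipticCurves.ZpExtension Literature.NumberTheory.EllipticCurves.Kobayashi2003
  Summit.BirchSwinnertonDyer.Rank1Residual.Additive.PadicCyclotomicTower

/-! ## §7 The plus field `ℚ₂(u_m) ⊆ ℚ̄₂` and its Galois correspondence -/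

section Field

/-- `u_m = ζ_{2^m} + ζ_{2^m}⁻¹ ∈ ℚ₂(ζ_{2^m})`. [folklore] -/
theorem u_mem_layer (m : ℕ) : zeta 2 m + (zeta 2 m)⁻¹ ∈ layer 2 m :=
  IntermediateField.add_mem _ (zeta_mem_layer 2 m) (IntermediateField.inv_mem _ (zeta_mem_layer 2 m))

/-- `u_m ∈ ℚ₂(u_m)`. [folklore] -/
theorem u_mem_adjoin_u (m : ℕ) : zeta 2 m + (zeta 2 m)⁻¹ ∈ ℚ_[2]⟮zeta 2 m + (zeta 2 m)⁻¹⟯ :=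
  IntermediateField.mem_adjoin_simple_self _ _

/-- **`ℚ₂(u_m) ≤ ℚ₂(ζ_{2^m})`** (`ℚ_{2,n}·ℚ₂ ⊆ ℚ₂(ζ_{2^{n+2}})`, `m = n + 2`). [cite: Washington1997, §13.1] -/
theorem adjoin_u_le_layer (m : ℕ) : ℚ_[2]⟮zeta 2 m + (zeta 2 m)⁻¹⟯ ≤ layer 2 m :=
  IntermediateField.adjoin_simple_le_iff.mpr (u_mem_layer m)

/-- `ℚ₂(u_m)` is finite over `ℚ₂` (a theorem, to be introduced with `haveI`). [folklore] -/
theorem finiteDimensional_adjoin_u (m : ℕ) : FiniteDimensional ℚ_[2] ℚ_[2]⟮zeta 2 m + (zeta 2 m)⁻¹⟯ :=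
  IntermediateField.adjoin.finiteDimensional (Algebra.IsIntegral.isIntegral _)

/-- **An automorphism fixing `u_m` fixes `ℚ₂(u_m)` pointwise** (its elements are polynomials in `u_m`). [folklore] -/
theorem apply_eq_self_of_apply_u_eq {m : ℕ} {σ : PadicAlgCl 2 ≃ₐ[ℚ_[2]] PadicAlgCl 2}
    (h : σ (zeta 2 m + (zeta 2 m)⁻¹) = zeta 2 m + (zeta 2 m)⁻¹) {x : PadicAlgCl 2}
    (hx : x ∈ ℚ_[2]⟮zeta 2 m + (zeta 2 m)⁻¹⟯) : σ x = x := by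
  have halg : IsAlgebraic ℚ_[2] (zeta 2 m + (zeta 2 m)⁻¹) := Algebra.IsAlgebraic.isAlgebraic _
  have hx' : x ∈ (ℚ_[2]⟮zeta 2 m + (zeta 2 m)⁻¹⟯).toSubalgebra := hx
  rw [IntermediateField.adjoin_simple_toSubalgebra_of_isAlgebraic halg, Algebra.adjoin_singleton_eq_range_aeval] at hx'
  obtain ⟨q, rfl⟩ := hx'
  change (σ : PadicAlgCl 2 →ₐ[ℚ_[2]] PadicAlgCl 2) (aeval (zeta 2 m + (zeta 2 m)⁻¹) q) = _
  rw [← aeval_algHom_apply]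
  change aeval (σ (zeta 2 m + (zeta 2 m)⁻¹)) q = _
  rw [h]
  rfl

/-- **An element fixed by every automorphism fixing `u_m` lies in `ℚ₂(u_m)`** (Galois correspondence for `ℚ̄₂/ℚ₂`, Mathlib
`InfiniteGalois.fixedField_fixingSubgroup`). [cite: NeukirchANT1999, Ch. IV §1] -/
theorem mem_adjoin_u_of_forall_apply_eq {m : ℕ} {x : PadicAlgCl 2}
    (hx : ∀ σ : PadicAlgCl 2 ≃ₐ[ℚ_[2]] PadicAlgCl 2, σ (zeta 2 m + (zeta 2 m)⁻¹) = zeta 2 m + (zeta 2 m)⁻¹ → σ x = x) :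
    x ∈ ℚ_[2]⟮zeta 2 m + (zeta 2 m)⁻¹⟯ := by
  rw [← InfiniteGalois.fixedField_fixingSubgroup ℚ_[2]⟮zeta 2 m + (zeta 2 m)⁻¹⟯]
  intro σ
  have hσ : (σ : PadicAlgCl 2 ≃ₐ[ℚ_[2]] PadicAlgCl 2) (zeta 2 m + (zeta 2 m)⁻¹) = zeta 2 m + (zeta 2 m)⁻¹ := by
    have := σ.2
    rw [IntermediateField.mem_fixingSubgroup_iff] at this
    exact this _ (u_mem_adjoin_u m)
  exact hx σ hσ

/-- **Galois correspondence for the plus field: `x ∈ ℚ₂(u_m) ⟺ x` is fixed by every automorphism of `ℚ̄₂/ℚ₂` fixing `u_m`.**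
[cite: NeukirchANT1999, Ch. IV §1] [cite: Washington1997, Prop. 2.16] -/
theorem mem_adjoin_u_iff_forall_apply_eq {m : ℕ} (x : PadicAlgCl 2) :
    x ∈ ℚ_[2]⟮zeta 2 m + (zeta 2 m)⁻¹⟯ ↔
      ∀ σ : PadicAlgCl 2 ≃ₐ[ℚ_[2]] PadicAlgCl 2, σ (zeta 2 m + (zeta 2 m)⁻¹) = zeta 2 m + (zeta 2 m)⁻¹ → σ x = x :=
  ⟨fun hx _ hσ ↦ apply_eq_self_of_apply_u_eq hσ hx, mem_adjoin_u_of_forall_apply_eq⟩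

/-- Membership in the fixing subgroup of `ℚ₂(u_m)` is fixing `u_m`. [folklore] -/
theorem mem_fixingSubgroup_adjoin_u_iff {m : ℕ} (σ : PadicAlgCl 2 ≃ₐ[ℚ_[2]] PadicAlgCl 2) :
    σ ∈ (ℚ_[2]⟮zeta 2 m + (zeta 2 m)⁻¹⟯).fixingSubgroup ↔ σ (zeta 2 m + (zeta 2 m)⁻¹) = zeta 2 m + (zeta 2 m)⁻¹ := by
  rw [IntermediateField.mem_fixingSubgroup_iff]
  exact ⟨fun h ↦ h _ (u_mem_adjoin_u m), fun h x hx ↦ apply_eq_self_of_apply_u_eq h hx⟩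

/-- **`ℚ₂(u_m)` is Galois-stable**: `σ x ∈ ℚ₂(u_m)` for `x ∈ ℚ₂(u_m)` (`σ u_m = ζ^a + ζ^{-a}` is again in `ℚ₂(u_m) ⊆ ℚ₂(ζ)`…; proved
through the correspondence: automorphisms fixing `u_m` form a NORMAL subgroup, `Stab(u_m) = Gal(ℚ̄₂/ℚ_{2,m−2})`). [cite: Washington1997, §13.1] -/
theorem apply_mem_adjoin_u {m : ℕ} (σ : PadicAlgCl 2 ≃ₐ[ℚ_[2]] PadicAlgCl 2) {x : PadicAlgCl 2}
    (hx : x ∈ ℚ_[2]⟮zeta 2 m + (zeta 2 m)⁻¹⟯) : σ x ∈ ℚ_[2]⟮zeta 2 m + (zeta 2 m)⁻¹⟯ := by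
  refine mem_adjoin_u_of_forall_apply_eq fun τ hτ ↦ ?_
  -- `σ⁻¹ τ σ` fixes `u_m`: all automorphisms act on `ζ_m` by powers, hence commute on `ℚ₂(ζ_m) ∋ u_m, x`
  obtain ⟨a, -, ha⟩ := exists_apply_zeta_eq_pow 2 σ m
  obtain ⟨b, -, hb⟩ := exists_apply_zeta_eq_pow 2 τ m
  have hcomm : ∀ y ∈ layer 2 m, σ (τ y) = τ (σ y) := by
    intro y hy
    obtain ⟨r, -, rfl⟩ := exists_aeval_zeta_eq 2 hy
    change (σ : PadicAlgCl 2 →ₐ[ℚ_[2]] PadicAlgCl 2) ((τ : PadicAlgCl 2 →ₐ[ℚ_[2]] PadicAlgCl 2) (aeval (zeta 2 m) r)) =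
      (τ : PadicAlgCl 2 →ₐ[ℚ_[2]] PadicAlgCl 2) ((σ : PadicAlgCl 2 →ₐ[ℚ_[2]] PadicAlgCl 2) (aeval (zeta 2 m) r))
    rw [← aeval_algHom_apply, ← aeval_algHom_apply, ← aeval_algHom_apply, ← aeval_algHom_apply]
    change aeval (σ (τ (zeta 2 m))) r = aeval (τ (σ (zeta 2 m))) r
    rw [hb, map_pow, ha, map_pow, hb, ← pow_mul, ← pow_mul, mul_comm]
  rw [← hcomm x (adjoin_u_le_layer m hx), apply_eq_self_of_apply_u_eq hτ hx]

end Field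

/-! ## §8 The plus field IS the completed layer `ℚ_{2,n}·ℚ₂` of the cyclotomic `ℤ₂`-extension -/

section Layer

variable {κ : ZpExtension ℚ 2} (ι : AlgebraicClosure ℚ →ₐ[ℚ] PadicAlgCl 2)

/-- **`x ∈ ℚ₂(u_{n+2}) ⟺ ∀ τ ∈ Gal(ℚ̄₂/ℚ_{2,n}), τ•x = x`**: the plus field `ℚ₂(ζ_{2^{n+2}} + ζ_{2^{n+2}}⁻¹)` is the fixed field of
Kobayashi's local layer subgroup `localLayerSubgroupOfEmb κ ι n` for the cyclotomic `ℤ₂`-extension, for EVERY embedding `ι : ℚ̄ → ℚ̄₂`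
(part II: that subgroup is `Stab(u_{n+2})`). [cite: Kobayashi2003, Def. 1.1] [cite: Washington1997, §13.1] -/
theorem mem_adjoin_u_iff_forall_mem_localLayerSubgroupOfEmb (hκ : κ.IsCyclotomic) (n : ℕ) (x : PadicAlgCl 2) :
    x ∈ ℚ_[2]⟮zeta 2 (n + 2) + (zeta 2 (n + 2))⁻¹⟯ ↔
      ∀ τ : absoluteGaloisGroup ℚ_[2], τ ∈ localLayerSubgroupOfEmb κ ι n → τ • x = x := by
  rw [mem_adjoin_u_iff_forall_apply_eq]
  constructor
  · intro h τ hτ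
    rw [absoluteGaloisGroup.smul_def]
    exact h _ ((mem_localLayerSubgroupOfEmb_two_iff_apply_u ι hκ n τ).mp hτ)
  · intro h σ hσ
    have hmem : (absoluteGaloisGroup.toAlgEquiv ℚ_[2]).symm σ ∈ localLayerSubgroupOfEmb κ ι n :=
      (mem_localLayerSubgroupOfEmb_two_iff_apply_u ι hκ n _).mpr (by simpa using hσ)
    have := h _ hmem
    rwa [absoluteGaloisGroup.toAlgEquiv_symm_apply] at this

/-- `Gal(ℚ̄₂/ℚ_{2,n})` is the pull-back of the fixing subgroup of `ℚ₂(u_{n+2})` along `Γ_{ℚ₂} = Aut(ℚ̄₂/ℚ₂)`. [cite: Washington1997, §13.1] -/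
theorem localLayerSubgroupOfEmb_two_eq_comap_fixingSubgroup (hκ : κ.IsCyclotomic) (n : ℕ) :
    localLayerSubgroupOfEmb κ ι n =
      ((ℚ_[2]⟮zeta 2 (n + 2) + (zeta 2 (n + 2))⁻¹⟯).fixingSubgroup).comap (absoluteGaloisGroup.toAlgEquiv ℚ_[2]).toMonoidHom := by
  ext τ
  rw [Subgroup.mem_comap, MulEquiv.coe_toMonoidHom, mem_fixingSubgroup_adjoin_u_iff,
    mem_localLayerSubgroupOfEmb_two_iff_apply_u ι hκ n τ]

/-- **`x ∈ ℚ₂(u_{n+2}) ⟺ x ∈ ℚ₂(ζ_{2^{n+2}}) ∧ σ₀•x = x`** for ANY inverter `σ₀` of `ζ_{2^{n+2}}` — the `Δ`-descent form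
(`ℚ₂(u_{n+2}) = ℚ₂(ζ_{2^{n+2}})^{⟨σ₀⟩}`), matching part II's `mem_localLayerPointsOfEmb_two_iff_stab`. [cite: Washington1997, §13.1 and Prop. 2.16] -/
theorem mem_adjoin_u_iff_mem_layer_and_smul_eq {n : ℕ} {σ₀ : absoluteGaloisGroup ℚ_[2]}
    (hσ₀ : σ₀ • zeta 2 (n + 2) = (zeta 2 (n + 2))⁻¹) (x : PadicAlgCl 2) :
    x ∈ ℚ_[2]⟮zeta 2 (n + 2) + (zeta 2 (n + 2))⁻¹⟯ ↔ x ∈ layer 2 (n + 2) ∧ σ₀ • x = x := by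
  -- a cyclotomic `κ` and an embedding exist; use the layer-subgroup description of part II
  have hκ := CyclotomicZp.isCyclotomic_zpExtension 2
  set ι₀ : AlgebraicClosure ℚ →ₐ[ℚ] PadicAlgCl 2 := closureEmb (K := ℚ) ℚ_[2]
  rw [mem_adjoin_u_iff_forall_mem_localLayerSubgroupOfEmb ι₀ hκ n, mem_layer_iff_forall_smul_eq]
  constructor
  · intro h
    exact ⟨fun τ hτ ↦ h τ (stab_le_localLayerSubgroupOfEmb_two ι₀ hκ n hτ),
      h σ₀ ((mem_localLayerSubgroupOfEmb_two_iff_zeta ι₀ hκ n σ₀).mpr (Or.inr hσ₀))⟩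
  · rintro ⟨hfix, h0⟩ τ hτ
    rcases (mem_localLayerSubgroupOfEmb_two_iff_zeta ι₀ hκ n τ).mp hτ with h | h
    · exact hfix τ ((mem_stab_iff τ).mpr h)
    · have hinv : σ₀⁻¹ • zeta 2 (n + 2) = (zeta 2 (n + 2))⁻¹ := by
        rw [inv_smul_eq_iff, smul_inv'', hσ₀, inv_inv]
      have h1 : (τ * σ₀⁻¹) ∈ stab 2 (n + 2) := by
        rw [mem_stab_iff, mul_smul, hinv, smul_inv'', h, inv_inv]
      calc τ • x = (τ * σ₀⁻¹) • (σ₀ • x) := by rw [mul_smul, inv_smul_smul]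
        _ = (τ * σ₀⁻¹) • x := by rw [h0]
        _ = x := hfix _ h1

/-- `v_n = u_{n+2} − 2 ∈ ℚ₂(u_{n+2})` (the memo's uniformizer). [folklore] -/
theorem v_mem_adjoin_u (m : ℕ) : zeta 2 m + (zeta 2 m)⁻¹ - 2 ∈ ℚ_[2]⟮zeta 2 m + (zeta 2 m)⁻¹⟯ :=
  IntermediateField.sub_mem _ (u_mem_adjoin_u m) (by exact_mod_cast IntermediateField.natCast_mem _ 2)

end Layer

/-! ## §9 The tower of plus fields, degrees, closedness -/

section Tower

/-- `u_{m+1}² − 2 = u_m`. [cite: Washington1997, §13.1] -/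
theorem u_sq_sub_two (m : ℕ) : (zeta 2 (m + 1) + (zeta 2 (m + 1))⁻¹) ^ 2 - 2 = zeta 2 m + (zeta 2 m)⁻¹ := by
  rw [PlusTower.u_succ_sq]; ring

/-- `u_m ∈ ℚ₂(u_{m+1})`. [folklore] -/
theorem u_mem_adjoin_u_succ (m : ℕ) : zeta 2 m + (zeta 2 m)⁻¹ ∈ ℚ_[2]⟮zeta 2 (m + 1) + (zeta 2 (m + 1))⁻¹⟯ := by
  rw [← u_sq_sub_two m]
  exact IntermediateField.sub_mem _ (pow_mem (u_mem_adjoin_u (m + 1)) 2)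
    (by exact_mod_cast IntermediateField.natCast_mem _ 2)

/-- **The plus tower increases**: `ℚ₂(u_m) ≤ ℚ₂(u_{m'})` for `m ≤ m'`. [cite: Washington1997, §13.1] -/
theorem adjoin_u_mono : Monotone fun m ↦ ℚ_[2]⟮zeta 2 m + (zeta 2 m)⁻¹⟯ := by
  refine monotone_nat_of_le_succ fun m ↦ ?_
  exact IntermediateField.adjoin_simple_le_iff.mpr (u_mem_adjoin_u_succ m)

/-- `ℚ₂(u_2) = ℚ₂` (`u_2 = ζ_4 + ζ_4⁻¹ = 0`): the bottom layer `k_0 = ℚ₂`. [folklore] -/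
theorem adjoin_u_two_eq_bot : ℚ_[2]⟮zeta 2 2 + (zeta 2 2)⁻¹⟯ = ⊥ := by
  rw [PlusTower.u_two, IntermediateField.adjoin_simple_eq_bot_iff]
  exact zero_mem _

/-- `ℚ₂(u_1) = ℚ₂(u_0) = ℚ₂` as well (`u_1 = −2`, `u_0 = 2`). [folklore] -/
theorem adjoin_u_one_eq_bot : ℚ_[2]⟮zeta 2 1 + (zeta 2 1)⁻¹⟯ = ⊥ := by
  rw [PlusTower.u_one, IntermediateField.adjoin_simple_eq_bot_iff]
  exact IntermediateField.neg_mem _ (by exact_mod_cast IntermediateField.natCast_mem ⊥ 2)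

/-- **`[ℚ₂(u_{n+2}) : ℚ₂] = 2ⁿ`** (`= [Γ_{ℚ₂} : Gal(ℚ̄₂/ℚ_{2,n})]`, part II's `index_localLayerSubgroupOfEmb_two`, through
the Galois correspondence `IntermediateField.finrank_eq_fixingSubgroup_index`). [cite: Washington1997, §13.1] -/
theorem finrank_adjoin_u (n : ℕ) : Module.finrank ℚ_[2] ℚ_[2]⟮zeta 2 (n + 2) + (zeta 2 (n + 2))⁻¹⟯ = 2 ^ n := by
  haveI := finiteDimensional_adjoin_u (n + 2)
  have hκ := CyclotomicZp.isCyclotomic_zpExtension 2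
  have h := index_localLayerSubgroupOfEmb_two (closureEmb (K := ℚ) ℚ_[2]) hκ n
  rw [localLayerSubgroupOfEmb_two_eq_comap_fixingSubgroup (closureEmb (K := ℚ) ℚ_[2]) hκ n,
    Subgroup.index_comap_of_surjective _ (absoluteGaloisGroup.toAlgEquiv ℚ_[2]).surjective] at h
  rw [IntermediateField.finrank_eq_fixingSubgroup_index, h]

/-- `ℚ₂(u_m)` is closed in `ℚ̄₂` (finite-dimensional over the complete field `ℚ₂`). [folklore] -/
theorem isClosed_adjoin_u (m : ℕ) :
    IsClosed ((ℚ_[2]⟮zeta 2 m + (zeta 2 m)⁻¹⟯ : IntermediateField ℚ_[2] (PadicAlgCl 2)) : Set (PadicAlgCl 2)) := by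
  haveI := finiteDimensional_adjoin_u m
  haveI : FiniteDimensional ℚ_[2] (Subalgebra.toSubmodule (ℚ_[2]⟮zeta 2 m + (zeta 2 m)⁻¹⟯).toSubalgebra) :=
    (inferInstance : FiniteDimensional ℚ_[2] ℚ_[2]⟮zeta 2 m + (zeta 2 m)⁻¹⟯)
  exact Submodule.closed_of_finiteDimensional (Subalgebra.toSubmodule (ℚ_[2]⟮zeta 2 m + (zeta 2 m)⁻¹⟯).toSubalgebra)

end Tower

end Summit.BirchSwinnertonDyer.BirchSwinnertonDyer.Theorems.SignedEC.PlusLayer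

end
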